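import Literature.NumberTheory.Sieve.GoldstonPintzYildirimLemma3Asymptotic
import Literature.NumberTheory.Sieve.GoldstonPintzYildirimProposition2
import Literature.NumberTheory.Sieve.GoldstonPintzYildirimThetaEulerNorm
import Literature.NumberTheory.Sieve.GoldstonPintzYildirimThetaEulerRegion
import HarnessLib

/-!
# Goldston–Pintz–Yıldırım, *Primes in tuples I*: Proposition 2 holds

Trunk: NumberTheory / Sieve. DISCHARGE of the named fact
`Literature.NumberTheory.Sieve.GPY.proposition2` (GPY, *Primes in tuples. I*, Ann. of Math. 170
(2009) = arXiv:math/0508185, Proposition 2, (2.15), proved in §9 from Lemma 3 of §8 and the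
Bombieri–Vinogradov theorem): `proposition2_holds : proposition2`.

The route (all PROVED in the tree): §9 (9.7)–(9.14) — the reduction of
`∑ Λ_R(n;H₁,ℓ₁)Λ_R(n;H₂,ℓ₂)θ(n+h₀)` to `N·𝒯̃_R + O(N/(log N)^A)` by Bombieri–Vinogradov
(`GoldstonPintzYildirimTheta`, `…ThetaBV`: `proposition2_of_mainTerm`); §9 (9.15)–(9.23) — the
two-variable Euler product `G = GStar` with `G(0,0) = 𝔖(H⁰)`, holomorphic on `{Re sᵢ > −1/4}` and
bounded as in (8.3) (`…ThetaEuler*`, `…ThetaLemma3T`, `…Proposition2`: `proposition2_of_lemma3`);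
§8 Lemma 3 — the two-variable contour evaluation (`…Lemma3Setup/Inner/Outer/Diag/Pieces`, the
explicit bound `…Lemma3Bound`, its `o(1)`-form `…Lemma3Asymptotic`). This file closes the chain:

* `norm_GStar_le_rpow` — (8.3) for `GStar` on the shrinking strips `Re sᵢ ≥ −3/log log R`,
  `h ≤ R`, `k₁ + k₂ ≤ M`: `|G*| ≤ K_M (log log R)^{P_M}`;
* `lemma3_GStar` — Lemma 3 for `G = GStar` in the form `hL3` of `proposition2_of_lemma3`
  (`lemma3_asymptotic_x` + `norm_GStar_le_rpow` + `GStar_zero_zero` + `x^Q e^{−x} → 0`);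
* `proposition2_holds : proposition2`.

## References

* D. A. Goldston, J. Pintz, C. Y. Yıldırım, *Primes in tuples. I*, Ann. of Math. (2) 170 (2009),
  819–862, doi:10.4007/annals.2009.170.819 = arXiv:math/0508185, Proposition 2 (2.15), §8
  Lemma 3 and (8.3), §9. [cite: GoldstonPintzYildirim2009]
-/

noncomputable section

open Complex Filter Topology MeasureTheory Set
open scoped Real

namespace Literature.NumberTheory.Sieve.GPY

section GStarFinal

open Finset

/-! ### The bound (8.3) for `G = GStar` on the shrinking strips -/

/-- `log(2h) ≤ log 2 + eˣ` for `h ≤ exp(exp x)`. [folklore] -/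
theorem log_two_mul_le_of_le_exp_exp {h : ℕ} {x : ℝ} (hh : (h : ℝ) ≤ Real.exp (Real.exp x)) :
    Real.log (2 * h) ≤ Real.log 2 + Real.exp x := by
  rcases Nat.eq_zero_or_pos h with h0 | hpos
  · rw [h0, Nat.cast_zero, mul_zero, Real.log_zero]
    have := Real.log_two_gt_d9
    positivity
  · have hh0 : (0 : ℝ) < h := by exact_mod_cast hpos
    calc Real.log (2 * h) ≤ Real.log (2 * Real.exp (Real.exp x)) :=
          Real.log_le_log (by positivity) (by linarith)
      _ = Real.log 2 + Real.exp x := by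
          rw [Real.log_mul two_ne_zero (Real.exp_pos _).ne', Real.log_exp]

/-- **`|G*| ≤ K x^P` on `Re sᵢ ≥ −3/x`** (`x = log log R ≥ 48`, `h ≤ R`, `k₁ + k₂ ≤ M`): the bound
(8.3) `|G*| ≤ exp(k* U^{δ₁+δ₂}(4 log log U + 25))` of `norm_GStar_le` with `U ≤ (16 + 96M²) eˣ`,
`δ₁ + δ₂ ≤ 6/x`, so `U^{δ₁+δ₂} ≤ (16+96M²)e⁶` and `log log U ≤ log x + O_M(1)`.
[cite: GoldstonPintzYildirim2009, Section 8 eq. 8.3] -/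
theorem norm_GStar_le_rpow (M : ℕ) :
    ∃ K P : ℝ, 0 ≤ K ∧ 0 ≤ P ∧ ∀ x : ℝ, 48 ≤ x → ∀ (h h₀ : ℕ) (H₁ H₂ : Finset ℕ),
      (h : ℝ) ≤ Real.exp (Real.exp x) → (∀ y ∈ insert h₀ (H₁ ∪ H₂), y ≤ h) → 1 ≤ #H₁ + #H₂ →
      #H₁ + #H₂ ≤ M → ∀ s₁ s₂ : ℂ, -(3 / x) ≤ s₁.re → -(3 / x) ≤ s₂.re →
      ‖GStar h₀ H₁ H₂ (caseA h₀ H₁) (caseA h₀ H₂) (caseD h₀ H₁ H₂) s₁ s₂‖ ≤ K * x ^ P := by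
  obtain ⟨D, hD⟩ : ∃ D : ℝ, D = 16 + 96 * (M : ℝ) ^ 2 := ⟨_, rfl⟩
  have hD16 : 16 ≤ D := by rw [hD]; nlinarith [sq_nonneg (M : ℝ)]
  have hD1 : 1 ≤ D := by linarith
  have hD0 : 0 < D := by linarith
  have hlD : 0 ≤ Real.log D := Real.log_nonneg hD1
  refine ⟨Real.exp (4 * M * (D * Real.exp 6) * (4 * Real.log (1 + Real.log D) + 25)),
    16 * M * (D * Real.exp 6), (Real.exp_pos _).le, by positivity, ?_⟩
  intro x hx h h₀ H₁ H₂ hh hmem hk hkM s₁ s₂ hs₁ hs₂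
  have hx0 : 0 < x := by linarith
  have hx1 : 1 ≤ x := by linarith
  have h3x : 3 / x ≤ 1 / 16 := by rw [div_le_div_iff₀ hx0 (by norm_num)]; linarith
  have h8₁ : -1 / 8 ≤ s₁.re := by linarith
  have h8₂ : -1 / 8 ≤ s₂.re := by linarith
  refine (norm_GStar_le hk hmem h8₁ h8₂).trans ?_
  -- the quantities in the exponent
  have hU16 := sixteen_le_gpyU (4 * (#H₁ + #H₂)) h
  have hU1 : 1 ≤ gpyU (4 * (#H₁ + #H₂)) h := by linarith
  have hU0 : 0 < gpyU (4 * (#H₁ + #H₂)) h := by linarith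
  have hkR : ((4 * (#H₁ + #H₂) : ℕ) : ℝ) ≤ 4 * M := by exact_mod_cast Nat.mul_le_mul_left 4 hkM
  have hk16 : ((4 * (#H₁ + #H₂) : ℕ) : ℝ) ^ 2 ≤ 16 * (M : ℝ) ^ 2 := by nlinarith [hkR, sq_nonneg (M : ℝ)]
  have hex1 : 1 ≤ Real.exp x := Real.one_le_exp hx0.le
  -- `U ≤ D eˣ`
  have hUD : gpyU (4 * (#H₁ + #H₂)) h ≤ D * Real.exp x := by
    have hDe : D ≤ D * Real.exp x := le_mul_of_one_le_right hD0.le hex1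
    unfold gpyU
    refine max_le (max_le (by linarith) ?_) ?_
    · nlinarith
    · have hl := log_two_mul_le_of_le_exp_exp hh
      have hl2 : Real.log 2 ≤ Real.exp x := by have := Real.log_two_lt_d9; linarith
      have hl0 : 0 ≤ Real.log 2 + Real.exp x := by have := Real.log_two_gt_d9; positivity
      calc ((4 * (#H₁ + #H₂) : ℕ) : ℝ) ^ 2 * Real.log (2 * h)
          ≤ 16 * (M : ℝ) ^ 2 * (Real.log 2 + Real.exp x) := by
            rcases le_or_gt 0 (Real.log (2 * h)) with hpos | hneg
            · exact mul_le_mul hk16 hl hpos (by positivity)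
            · exact le_trans (mul_nonpos_of_nonneg_of_nonpos (by positivity) hneg.le) (by positivity)
        _ ≤ 16 * (M : ℝ) ^ 2 * (2 * Real.exp x) := by gcongr; linarith
        _ ≤ D * Real.exp x := by rw [hD]; nlinarith [Real.exp_pos x, sq_nonneg (M : ℝ)]
  -- `U^δ ≤ D e⁶`
  have hδ0 : 0 ≤ max (-s₁.re) 0 + max (-s₂.re) 0 := by positivity
  have hδ : max (-s₁.re) 0 + max (-s₂.re) 0 ≤ 6 / x := by
    have h1 : max (-s₁.re) 0 ≤ 3 / x := max_le (by linarith) (by positivity)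
    have h2 : max (-s₂.re) 0 ≤ 3 / x := max_le (by linarith) (by positivity)
    have : (6 : ℝ) / x = 3 / x + 3 / x := by ring
    linarith
  have hUδ : gpyU (4 * (#H₁ + #H₂)) h ^ (max (-s₁.re) 0 + max (-s₂.re) 0) ≤ D * Real.exp 6 := by
    calc gpyU (4 * (#H₁ + #H₂)) h ^ (max (-s₁.re) 0 + max (-s₂.re) 0)
        ≤ gpyU (4 * (#H₁ + #H₂)) h ^ (6 / x) := Real.rpow_le_rpow_of_exponent_le hU1 hδ
      _ ≤ (D * Real.exp x) ^ (6 / x) := Real.rpow_le_rpow hU0.le hUD (by positivity)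
      _ = D ^ (6 / x) * Real.exp x ^ (6 / x) := Real.mul_rpow hD0.le (Real.exp_pos x).le
      _ ≤ D ^ (1 : ℝ) * Real.exp 6 := by
          refine mul_le_mul (Real.rpow_le_rpow_of_exponent_le hD1 ?_) (le_of_eq ?_) (by positivity)
            (by positivity)
          · rw [div_le_one hx0]; linarith
          · rw [← Real.exp_mul]; congr 1; field_simp
      _ = D * Real.exp 6 := by rw [Real.rpow_one]
  -- `log log U ≤ log x + log(1 + log D)`
  have hlU : 1 ≤ Real.log (gpyU (4 * (#H₁ + #H₂)) h) := by
    rw [Real.le_log_iff_exp_le hU0]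
    have := Real.exp_one_lt_d9
    linarith
  have hll : Real.log (Real.log (gpyU (4 * (#H₁ + #H₂)) h)) ≤ Real.log x + Real.log (1 + Real.log D) := by
    have h1 : Real.log (gpyU (4 * (#H₁ + #H₂)) h) ≤ Real.log D + x := by
      have := Real.log_le_log hU0 hUD
      rwa [Real.log_mul hD0.ne' (Real.exp_pos x).ne', Real.log_exp] at this
    have h2 : Real.log D + x ≤ x * (1 + Real.log D) := by nlinarith
    calc Real.log (Real.log (gpyU (4 * (#H₁ + #H₂)) h)) ≤ Real.log (x * (1 + Real.log D)) :=
          Real.log_le_log (by linarith) (h1.trans h2)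
      _ = Real.log x + Real.log (1 + Real.log D) := Real.log_mul hx0.ne' (by linarith)
  have hll0 : 0 ≤ Real.log (Real.log (gpyU (4 * (#H₁ + #H₂)) h)) := Real.log_nonneg hlU
  -- the exponent
  rw [Real.rpow_def_of_pos hx0, ← Real.exp_add]
  refine Real.exp_le_exp.2 ?_
  calc ((4 * (#H₁ + #H₂) : ℕ) : ℝ) * gpyU (4 * (#H₁ + #H₂)) h ^ (max (-s₁.re) 0 + max (-s₂.re) 0) *
        (4 * Real.log (Real.log (gpyU (4 * (#H₁ + #H₂)) h)) + 25)
      ≤ (4 * M) * (D * Real.exp 6) * (4 * (Real.log x + Real.log (1 + Real.log D)) + 25) := by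
        gcongr
    _ = 4 * M * (D * Real.exp 6) * (4 * Real.log (1 + Real.log D) + 25) +
        Real.log x * (16 * M * (D * Real.exp 6)) := by ring

/-! ### Lemma 3 for `G = GStar`: the hypothesis `hL3` of `proposition2_of_lemma3` -/

/-- **GPY Lemma 3 for the `G` of Proposition 2** in the `o(1)`-form `hL3` of
`proposition2_of_lemma3`: for `R ≥ R₁(M, ε)`, `h ≤ R`, `1 ≤ h₀ ≤ h`, `Hᵢ ⊆ [0,h]`,
`1 ≤ k₁ + k₂`, `k₁ + k₂ + u + v ≤ M`, `a + u, b + v ≥ 1`: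
`‖𝒯*_R(a,b,d,u,v) − C(u+v,u)(log R)^{u+v+d}/(u+v+d)! · 𝔖(H⁰)‖ ≤ ε (log R)^{u+v+d}`
(`lemma3_asymptotic_x` + `norm_GStar_le_rpow` + `GStar_zero_zero` + `x^Q e^{−x} → 0`).
[cite: GoldstonPintzYildirim2009, Lemma 3] -/
theorem lemma3_GStar (M : ℕ) (ε : ℝ) (hε : 0 < ε) :
    ∃ R₁ : ℝ, ∀ (R : ℝ) (h h₀ : ℕ) (H₁ H₂ : Finset ℕ) (u v : ℕ),
      R₁ ≤ R → (h : ℝ) ≤ R → 1 ≤ h₀ → h₀ ≤ h → (∀ x ∈ H₁, x ≤ h) → (∀ x ∈ H₂, x ≤ h) →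
      1 ≤ #H₁ + #H₂ → #H₁ + #H₂ + u + v ≤ M → 1 ≤ caseA h₀ H₁ + u → 1 ≤ caseA h₀ H₂ + v →
      ‖lemma3T (fun s₁ s₂ => GStar h₀ H₁ H₂ (caseA h₀ H₁) (caseA h₀ H₂) (caseD h₀ H₁ H₂) s₁ s₂) R
          (caseA h₀ H₁) (caseA h₀ H₂) (caseD h₀ H₁ H₂) u v -
        ((((u + v).choose u : ℝ) * Real.log R ^ (u + v + caseD h₀ H₁ H₂) /
            ((u + v + caseD h₀ H₁ H₂).factorial : ℝ) *
          singularSeriesNat (insert h₀ (H₁ ∪ H₂)) : ℝ) : ℂ)‖ ≤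
        ε * Real.log R ^ (u + v + caseD h₀ H₁ H₂) := by
  obtain ⟨C₀, x₀, hC₀, hx₀, HL⟩ := lemma3_asymptotic_x M
  obtain ⟨K, P, hK, hP, HG⟩ := norm_GStar_le_rpow M
  have ht := tendsto_rpow_mul_exp_neg_mul_atTop_nhds_zero (P + ((5 * M + 1 : ℕ) : ℝ)) 1 one_pos
  have hε' : 0 < ε / (C₀ * K + 1) := by positivity
  obtain ⟨x₂, hx₂⟩ := (ht.eventually (gt_mem_nhds hε')).exists_forall_of_atTop
  refine ⟨Real.exp (Real.exp (max x₀ x₂)), ?_⟩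
  intro R h h₀ H₁ H₂ u v hR hh h₀1 h₀h hH₁ hH₂ hk hkM hau hbv
  -- `x = log log R`, `R = exp(exp x)`
  have hm : x₀ ≤ max x₀ x₂ := le_max_left _ _
  have hR1 : 1 < R := lt_of_lt_of_le (by
    have : (0 : ℝ) < Real.exp (max x₀ x₂) := Real.exp_pos _
    calc (1 : ℝ) = Real.exp 0 := Real.exp_zero.symm
      _ < Real.exp (Real.exp (max x₀ x₂)) := Real.exp_lt_exp.2 this) hR
  have hlogR : 0 < Real.log R := Real.log_pos hR1
  obtain ⟨x, hxdef⟩ : ∃ x : ℝ, Real.log (Real.log R) = x := ⟨_, rfl⟩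
  have hexpx : Real.exp x = Real.log R := by rw [← hxdef, Real.exp_log hlogR]
  have hRx : Real.exp (Real.exp x) = R := by rw [hexpx, Real.exp_log (by linarith)]
  have hxge : max x₀ x₂ ≤ x := by
    have h1 := Real.log_le_log (Real.exp_pos _) hR
    rw [Real.log_exp] at h1
    have h2 := Real.log_le_log (Real.exp_pos _) h1
    rwa [Real.log_exp, hxdef] at h2
  have hx₀x : x₀ ≤ x := le_trans (le_max_left _ _) hxge
  have hx₂x : x₂ ≤ x := le_trans (le_max_right _ _) hxge
  have hx48 : 48 ≤ x := by linarith
  have hx0 : 0 < x := by linarith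
  -- the `G*` bound on the strip `Re sᵢ ≥ -3/x`
  have hmem : ∀ y ∈ insert h₀ (H₁ ∪ H₂), y ≤ h := by
    intro y hy
    rcases Finset.mem_insert.1 hy with rfl | hy
    · exact h₀h
    · rcases Finset.mem_union.1 hy with hy | hy
      · exact hH₁ y hy
      · exact hH₂ y hy
  have hhR : (h : ℝ) ≤ Real.exp (Real.exp x) := by rw [hRx]; exact hh
  have hGB : ∀ s₁ s₂ : ℂ, -(3 / x) ≤ s₁.re → s₁.re ≤ 2 → -(3 / x) ≤ s₂.re → s₂.re ≤ 2 →
      ‖(fun s₁ s₂ => GStar h₀ H₁ H₂ (caseA h₀ H₁) (caseA h₀ H₂) (caseD h₀ H₁ H₂) s₁ s₂) s₁ s₂‖ ≤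
        K * x ^ P :=
    fun s₁ s₂ h1 _ h2 _ => HG x hx48 h h₀ H₁ H₂ hhR hmem hk (by omega) s₁ s₂ h1 h2
  -- the sizes
  have hA : caseA h₀ H₁ ≤ M := (Finset.card_erase_le).trans (by omega)
  have hB : caseA h₀ H₂ ≤ M := (Finset.card_erase_le).trans (by omega)
  have hDM : caseD h₀ H₁ H₂ ≤ M := (caseD_le_card h₀ H₁ H₂).trans (by omega)
  -- Lemma 3
  have H := HL x hx₀x (caseA h₀ H₁) (caseA h₀ H₂) (caseD h₀ H₁ H₂) u v hA hB hDM (by omega) (by omega)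
    hau hbv _ (K * x ^ P) (by positivity) (differentiableOn_GStar₂_region h₀ H₁ H₂) hGB
  rw [hRx] at H
  -- the main term
  have hmt : (fun s₁ s₂ => GStar h₀ H₁ H₂ (caseA h₀ H₁) (caseA h₀ H₂) (caseD h₀ H₁ H₂) s₁ s₂) 0 0 *
      ((((u + v).choose u : ℕ) : ℂ) * (Real.log R : ℂ) ^ (u + v + caseD h₀ H₁ H₂) /
        ((u + v + caseD h₀ H₁ H₂).factorial : ℂ)) =
      ((((u + v).choose u : ℝ) * Real.log R ^ (u + v + caseD h₀ H₁ H₂) /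
            ((u + v + caseD h₀ H₁ H₂).factorial : ℝ) *
          singularSeriesNat (insert h₀ (H₁ ∪ H₂)) : ℝ) : ℂ) := by
    show GStar h₀ H₁ H₂ (caseA h₀ H₁) (caseA h₀ H₂) (caseD h₀ H₁ H₂) 0 0 * _ = _
    rw [GStar_zero_zero]
    push_cast
    ring
  rw [hmt] at H
  refine H.trans ?_
  -- `C₀ K x^P x^{5M+1} (log R)^e / log R ≤ ε (log R)^e`
  rw [hexpx]
  have hsmall := hx₂ x hx₂x
  rw [Real.rpow_add hx0, Real.rpow_natCast, neg_one_mul] at hsmall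
  have hexp : (Real.log R)⁻¹ = Real.exp (-x) := by rw [← hexpx, Real.exp_neg]
  have hCK : C₀ * K * (ε / (C₀ * K + 1)) ≤ ε := by
    rw [← mul_div_assoc, div_le_iff₀ (by positivity)]; nlinarith
  calc C₀ * (K * x ^ P) * x ^ (5 * M + 1) * (Real.log R ^ (u + v + caseD h₀ H₁ H₂) / Real.log R)
      = C₀ * K * (x ^ P * x ^ (5 * M + 1) * Real.exp (-x)) * Real.log R ^ (u + v + caseD h₀ H₁ H₂) := by
        rw [div_eq_mul_inv, hexp]; ring
    _ ≤ C₀ * K * (ε / (C₀ * K + 1)) * Real.log R ^ (u + v + caseD h₀ H₁ H₂) := by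
        gcongr
    _ ≤ ε * Real.log R ^ (u + v + caseD h₀ H₁ H₂) := mul_le_mul_of_nonneg_right hCK (by positivity)

/-- **GPY Proposition 2 holds** (`proposition2_of_lemma3 lemma3_GStar`).
[cite: GoldstonPintzYildirim2009, Proposition 2] -/
theorem proposition2_holds : proposition2 :=
  proposition2_of_lemma3 lemma3_GStar

end GStarFinal

end Literature.NumberTheory.Sieve.GPY
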